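import Literature.Computability.AlgebraicComplexity.BLMW11KroneckerApproximation
import Literature.Computability.AlgebraicComplexity.LinSubstProofs
import Mathlib.LinearAlgebra.Matrix.MvPolynomial
import Mathlib.RingTheory.Localization.Away.Basic
import Mathlib.RingTheory.Localization.InvSubmonoid
import HarnessLib

/-!
# BLMW 2011, Lemma 9.4.1 (Hilbert 1893 / Kraft III.2.3) — reduction to Laurent points of
# closure points of images of polynomial maps

Bürgisser–Landsberg–Manivel–Weyman, *An overview of mathematical issues arising in the geometric
complexity theory approach to VP ≠ VNP*, SIAM J. Comput. 40 (2011) = arXiv:0907.2850, **Lemma 9.4.1**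
(v1: Lemma 9.4, held text `paper:arxiv-0907.2850` p0022): "Let `R = ℂ[[ε]]`, `K` its quotient
field … Suppose that `f` lies in the `GL_N(ℂ)`-orbit closure of `g ∈ SⁿℂN`. Then there exists
`σ ∈ GL_N(K)` such that `F := σ·g ∈ SⁿR^N` satisfies `(F)_{ε=0} = f`" — the tree's named fact
`BLMW2011_lemma_9_4_1` (`BLMW11KroneckerApproximation.lean`, typed for arbitrary polynomials `g`,
with `orbitClosure`, `linSubst`, `LaurentSeries ℂ`, `PowerSeries ℂ`). The printed proof is a
citation ("We refer to [20, III.2.3] for the general statement"; Kraft, *Geometrische Methoden in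
der Invariantentheorie*, III.2.3 Lemma 1, proved there by curve selection in the orbit closure and
the power-series expansion at a smooth point of a curve).

## What this file proves (theorems only; no new definitions of notions, no named facts)

`BLMW2011_lemma_9_4_1_of_laurentPoints`: the named fact FOLLOWS from the general
**Laurent-point lemma for images of polynomial maps of affine spaces** (hypothesis `H`, stated
inline, NOT vendored as a fact): for polynomials `φ_i, h ∈ ℂ[x_1,…,x_m]` and a point `y` in the
Zariski closure (tree `zariskiClosure`) of the image `φ(D(h))` of the basic open set `{h ≠ 0}`,
there is a `K = ℂ((ε))`-point `x(ε)` with `h(x(ε)) ≠ 0` and `φ_i(x(ε)) ∈ y_i + ε·ℂ[[ε]]` for all `i`.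
This is Kraft's lemma with the group replaced by an arbitrary basic open set of an affine space;
it is the statement a commutative-algebra proof (Noether normalisation, going down for integral
extensions of normal domains, Dedekind normalisation, completion of a discrete valuation ring with
residue field `ℂ`) delivers, and it is the only input of Lemma 9.4.1 that is not bookkeeping.

The reduction (this file): for `g` of total degree `D` in the variables `Fin N`, the coefficients
of `A·g = linSubst A g` are polynomials `Φ_d(A)` in the `N²` entries of `A`
(`HilbertKraft.orbitCoeffPoly`, the coefficients of the substitution of the GENERIC matrix
`Matrix.mvPolynomialX`, specialised along any base change — `HilbertKraft.aeval_orbitCoeffPoly`);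
the orbit `GL_N(ℂ)·g` is the image of `D(det)` under `A ↦ (Φ_d(A))_d`; membership of `f` in the
tree's `orbitClosure g` (Zariski closure of the coefficient vectors of the orbit, in the space of
ALL coefficients) restricts to the finitely many monomials of degree `≤ D`
(`HilbertKraft.coeff_restrict_mem_zariskiClosure`) and forces `coeff d f = 0` beyond degree `D`
(`HilbertKraft.coeff_eq_zero_of_mem_orbitClosure`); the Laurent point `x(ε)` of `H` is the matrix
`σ = A(ε) ∈ GL_N(K)` (`det A(ε) = det(x(ε)) ≠ 0`), and `F := ∑_{|d| ≤ D} q_d · x^d` with the power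
series `q_d ∈ ℂ[[ε]]`, `q_d(0) = coeff d f`, supplied by `H` (`BLMW2011_lemma_9_4_1_of_laurentPoints`).

`HilbertKraft.laurentPoints_of_core` (§ "From the algebraic core"): hypothesis `H` in turn
FOLLOWS from the purely ring-theoretic statement CORE (again an explicit hypothesis, not a fact):
for a finitely generated `ℂ`-domain `R`, elements `a_i ∈ R` and a point `y ∈ ℂⁿ` satisfying every
polynomial relation of the `a_i`, there is a `ℂ`-algebra map `Ψ : R → ℂ((ε))` under which every
polynomial in the `a_i` becomes a power series with constant coefficient its value at `y`. (Apply
it to `R = ℂ[x][1/h]`; `x(ε) := Ψ(x)`; `h` is a unit of `R`.) So `BLMW2011_lemma_9_4_1` hinges on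
CORE alone (`BLMW2011_lemma_9_4_1_of_core`).

Honest framing: bookkeeping for a closure lemma of geometric complexity theory; nothing here bears
on lower bounds or on `VP` versus `VNP`. Cell val-lit (t14 g4), row BLMW2011-B.

## References

* [BurgisserEtAl2011] P. Bürgisser, J. M. Landsberg, L. Manivel, J. Weyman, SIAM J. Comput. 40(4)
  (2011) 1179–1209, arXiv:0907.2850, Lemma 9.4.1 (§9.4).
* [Kraft1984] H. Kraft, *Geometrische Methoden in der Invariantentheorie*, Aspects of Math. D1,
  Vieweg 1984, III.2.3 Lemma 1.
-/

noncomputable section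

namespace Literature.Computability.AlgebraicComplexity

open MvPolynomial

namespace HilbertKraft

universe u v w

/-! ### Base change of a linear substitution -/

section BaseChange

variable {σ : Type u} [Fintype σ] {R : Type v} {S : Type w} [CommRing R] [CommRing S]

/-- Base change of the linear substitution along a ring homomorphism `θ`:
`θ_*(A·p) = θ(A)·θ_*(p)` (the substitution action commutes with extension of scalars).
[cite: Landsberg2017, §1.2.5] -/
theorem map_linSubst (θ : R →+* S) (A : Matrix σ σ R) (p : MvPolynomial σ R) :
    map θ (linSubst σ R A p) = linSubst σ S (A.map θ) (map θ p) := by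
  change map θ (aeval _ p) = aeval _ (map θ p)
  rw [aeval_eq_bind₁, aeval_eq_bind₁, map_bind₁]
  congr 2
  funext i
  simp only [map_sum, smul_eq_C_mul, map_mul, map_C, map_X, Matrix.map_apply]

/-- A linear substitution does not raise the total degree (tree fact `totalDegree_linSubst_le`,
proved as `totalDegree_linSubst_le_holds`). [cite: Landsberg2017, §1.2.5] -/
theorem totalDegree_linSubst_le' (A : Matrix σ σ R) (p : MvPolynomial σ R) :
    (linSubst σ R A p).totalDegree ≤ p.totalDegree :=
  totalDegree_linSubst_le_holds A p

omit [Fintype σ] in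
/-- `map` (extension of scalars) does not raise the total degree. [cite: Landsberg2017, §1.2.5] -/
theorem totalDegree_map_le' (θ : R →+* S) (p : MvPolynomial σ R) :
    (map θ p).totalDegree ≤ p.totalDegree :=
  Finset.sup_mono (support_map_subset θ p)

end BaseChange

/-! ### The coefficients of `A·g` as polynomials in the entries of `A` -/

section Generic

variable {σ : Type} [Fintype σ] {k : Type} [CommRing k]

/-- `Φ_d(A)`: the coefficient of the monomial `x^d` in `A·g`, as a polynomial in the entries
`X_{(i,j)}` of the generic `σ × σ` matrix (`Matrix.mvPolynomialX`): the coefficient of `x^d` in the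
substitution of the generic matrix into `g` (coefficients extended along `C`).
[cite: BurgisserEtAl2011, §9.4 (proof of Lemma 9.4.1: the orbit map `σ ↦ σ·g`)] -/
def orbitCoeffPoly (g : MvPolynomial σ k) (d : σ →₀ ℕ) : MvPolynomial (σ × σ) k :=
  coeff d (linSubst σ (MvPolynomial (σ × σ) k) (Matrix.mvPolynomialX σ σ k)
    (map (C : k →+* MvPolynomial (σ × σ) k) g))

/-- **Specialisation.** Evaluating `Φ_d` at the entries `x (i,j)` of a matrix with entries in a
`k`-algebra `S` gives the `x^d`-coefficient of `A·g_S`, `A = (x(i,j))`, `g_S` the base change of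
`g`. [cite: BurgisserEtAl2011, §9.4 (proof of Lemma 9.4.1)] -/
theorem aeval_orbitCoeffPoly {S : Type w} [CommRing S] [Algebra k S] (g : MvPolynomial σ k)
    (d : σ →₀ ℕ) (x : σ × σ → S) :
    aeval x (orbitCoeffPoly g d) =
      coeff d (linSubst σ S (Matrix.of fun i j => x (i, j)) (map (algebraMap k S) g)) := by
  set θ : MvPolynomial (σ × σ) k →+* S := (aeval x).toRingHom with hθ
  have h1 : aeval x (orbitCoeffPoly g d) = θ (orbitCoeffPoly g d) := rfl
  have hM : (Matrix.mvPolynomialX σ σ k).map θ = Matrix.of fun i j => x (i, j) := by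
    ext i j
    rw [Matrix.map_apply, Matrix.mvPolynomialX_apply, Matrix.of_apply, hθ]
    exact aeval_X x (i, j)
  have hC : θ.comp C = algebraMap k S := by
    ext c
    rw [RingHom.comp_apply, hθ]
    exact aeval_C x c
  rw [h1, orbitCoeffPoly, ← coeff_map, map_linSubst, map_map, hM, hC]

/-- Specialisation at a matrix with entries in `k` itself. [cite: BurgisserEtAl2011, §9.4 (proof of Lemma 9.4.1)] -/
theorem eval_orbitCoeffPoly (g : MvPolynomial σ k) (d : σ →₀ ℕ) (A : Matrix σ σ k) :
    eval (fun ij : σ × σ => A ij.1 ij.2) (orbitCoeffPoly g d) = coeff d (linSubst σ k A g) := by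
  have h := aeval_orbitCoeffPoly (S := k) g d (fun ij : σ × σ => A ij.1 ij.2)
  have hA : (Matrix.of fun i j => A i j) = A := rfl
  rw [aeval_eq_eval, Algebra.algebraMap_self, map_id, hA] at h
  exact h

/-- The determinant of the generic matrix evaluates to the determinant (the orbit map of
`GL_N = D(det)`). [cite: BurgisserEtAl2011, §9.4 (proof of Lemma 9.4.1)] -/
theorem eval_det_mvPolynomialX [DecidableEq σ] (A : Matrix σ σ k) :
    eval (fun ij : σ × σ => A ij.1 ij.2) (Matrix.mvPolynomialX σ σ k).det = A.det := by
  rw [RingHom.map_det]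
  congr 1
  ext i j
  simp [Matrix.mvPolynomialX_apply]

/-- … and, over a `k`-algebra, `aeval x (det X) = det (x(i,j))` (the `K`-points of `GL_N`).
[cite: BurgisserEtAl2011, §9.4 (proof of Lemma 9.4.1)] -/
theorem aeval_det_mvPolynomialX [DecidableEq σ] {S : Type w} [CommRing S] [Algebra k S]
    (x : σ × σ → S) :
    aeval x (Matrix.mvPolynomialX σ σ k).det = (Matrix.of fun i j => x (i, j)).det := by
  rw [show aeval x (Matrix.mvPolynomialX σ σ k).det =
      (aeval x).toRingHom (Matrix.mvPolynomialX σ σ k).det from rfl, RingHom.map_det]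
  congr 1
  ext i j
  simp [Matrix.mvPolynomialX_apply]

end Generic

/-! ### Restricting the orbit-closure condition to finitely many coefficients -/

section Restrict

variable {N : ℕ}

/-- The finite set of monomials of degree `≤ D` in the variables `Fin N` — the finite-dimensional
pieces `{f | deg f ≤ d}` of BLMW 2011 §9.3. [cite: BurgisserEtAl2011, §9.3 (Def. 9.3.1)] -/
theorem mem_degBox_iff' {D : ℕ} {d : Fin N →₀ ℕ} :
    d ∈ (Finset.range (D + 1)).biUnion
      (fun n => (Finset.univ : Finset (Fin N)).finsuppAntidiag n) ↔ d.degree ≤ D := by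
  have hmem : ∀ n : ℕ,
      d ∈ (Finset.univ : Finset (Fin N)).finsuppAntidiag n ↔ d.degree = n := by
    intro n
    simp [Finset.mem_finsuppAntidiag, Finsupp.degree_eq_sum]
  rw [Finset.mem_biUnion]
  constructor
  · rintro ⟨n, hn, h⟩
    rw [hmem] at h
    rw [Finset.mem_range] at hn
    omega
  · intro h
    exact ⟨d.degree, Finset.mem_range.mpr (Nat.lt_succ_of_le h), (hmem _).mpr rfl⟩

/-- Coefficients of `A·g` vanish beyond the total degree of `g` (any commutative ring of
coefficients, any base change of `g`). [cite: Landsberg2017, §1.2.5] -/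
theorem coeff_linSubst_map_eq_zero {S : Type w} [CommRing S] (θ : ℂ →+* S)
    (A : Matrix (Fin N) (Fin N) S) (g : MvPolynomial (Fin N) ℂ) {d : Fin N →₀ ℕ}
    (hd : g.totalDegree < d.degree) :
    coeff d (linSubst (Fin N) S A (map θ g)) = 0 := by
  apply coeff_eq_zero_of_totalDegree_lt
  rw [← Finsupp.degree_apply]
  exact lt_of_le_of_lt ((totalDegree_linSubst_le' A _).trans (totalDegree_map_le' θ g)) hd

/-- A point of the orbit closure `Δ(g)` has no coefficients beyond the total degree of `g`: the
coordinate function `X_d` vanishes on the orbit. [cite: BurgisserEtAl2011, §9.3–9.4] -/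
theorem coeff_eq_zero_of_mem_orbitClosure {f g : MvPolynomial (Fin N) ℂ}
    (hf : f ∈ orbitClosure g) {d : Fin N →₀ ℕ} (hd : g.totalDegree < d.degree) :
    coeff d f = 0 := by
  have h := (mem_orbitClosure_iff.mp hf) (X d) fun h hh => by
    obtain ⟨u, rfl⟩ := hh
    show aeval (coeffVec (linSubstRep (Fin N) ℂ u g)) (X d : MvPolynomial (Fin N →₀ ℕ) ℂ) = 0
    rw [aeval_X, coeffVec_apply, linSubstRep_apply]
    simpa only [map_id] using
      coeff_linSubst_map_eq_zero (RingHom.id ℂ) (u : Matrix (Fin N) (Fin N) ℂ) g hd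
  simpa only [aeval_X, coeffVec_apply] using h

/-- **Restriction to finitely many coordinates.** If `f ∈ Δ(g)` then, for every finite set `S` of
monomials, the vector `(coeff d f)_{d ∈ S}` lies in the Zariski closure of the image of
`D(det) ⊆ ℂ^{N×N}` under `A ↦ (Φ_d(A))_{d ∈ S}`. [cite: BurgisserEtAl2011, §9.4 (proof of Lemma 9.4.1)] -/
theorem coeff_restrict_mem_zariskiClosure {f g : MvPolynomial (Fin N) ℂ} (hf : f ∈ orbitClosure g)
    (S : Finset (Fin N →₀ ℕ)) :
    (fun d : ↥S => coeff d.1 f) ∈ zariskiClosure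
      ((fun x : Fin N × Fin N → ℂ => fun d : ↥S => eval x (orbitCoeffPoly g d.1)) ''
        {x | eval x (Matrix.mvPolynomialX (Fin N) (Fin N) ℂ).det ≠ 0}) := by
  rw [mem_zariskiClosure_iff]
  intro p hp
  have key := (mem_orbitClosure_iff.mp hf) (rename (Subtype.val : ↥S → (Fin N →₀ ℕ)) p)
    fun h hh => by
      obtain ⟨u, rfl⟩ := hh
      rw [aeval_rename]
      set xu : Fin N × Fin N → ℂ := fun ij => (u : Matrix (Fin N) (Fin N) ℂ) ij.1 ij.2 with hxu
      have hx : xu ∈ {x : Fin N × Fin N → ℂ |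
          eval x (Matrix.mvPolynomialX (Fin N) (Fin N) ℂ).det ≠ 0} := by
        rw [Set.mem_setOf_eq, hxu, eval_det_mvPolynomialX]
        exact ((Units.isUnit u).map Matrix.detMonoidHom).ne_zero
      have h0 := hp _ ⟨xu, hx, rfl⟩
      have hfun : (coeffVec (linSubstRep (Fin N) ℂ u g) ∘ (Subtype.val : ↥S → (Fin N →₀ ℕ))) =
          fun d : ↥S => eval xu (orbitCoeffPoly g d.1) := by
        funext d
        rw [Function.comp_apply, coeffVec_apply, linSubstRep_apply, hxu, eval_orbitCoeffPoly]
      show aeval (coeffVec (linSubstRep (Fin N) ℂ u g) ∘ (Subtype.val : ↥S → (Fin N →₀ ℕ))) p = 0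
      rw [hfun]
      exact h0
  rwa [aeval_rename] at key

end Restrict

end HilbertKraft

/-! ### Lemma 9.4.1 from the Laurent-point lemma -/

open HilbertKraft in
/-- **BLMW 2011, Lemma 9.4.1, from the Laurent-point lemma for images of polynomial maps.**
Hypothesis `H` (Kraft III.2.3 in affine-space form; NOT asserted here): for polynomials
`φ_i, h ∈ ℂ[x_1,…,x_m]` (finite index types) and `y` in the Zariski closure of `φ({h ≠ 0})`, there
is `x(ε) ∈ ℂ((ε))^m` with `h(x(ε)) ≠ 0` and power series `q_i ∈ ℂ[[ε]]` with `φ_i(x(ε)) = q_i`,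
`q_i(0) = y_i`. Conclusion: the named fact `BLMW2011_lemma_9_4_1` — for `f ∈ Δ(g)` there are
`σ ∈ GL_N(ℂ((ε)))` and `F` over `ℂ[[ε]]` with `σ·g = F` and `F(ε = 0) = f`. Proof: apply `H` to the
coefficient polynomials `Φ_d`, `|d| ≤ deg g`, and `h = det` (`coeff_restrict_mem_zariskiClosure`);
`σ := (x(ε)_{ij})`, `F := ∑_{|d| ≤ deg g} q_d x^d`; coefficients beyond `deg g` vanish on both sides
(`coeff_linSubst_map_eq_zero`, `coeff_eq_zero_of_mem_orbitClosure`).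
[cite: BurgisserEtAl2011, Lemma 9.4.1] [cite: Kraft1984, III.2.3 Lemma 1] -/
theorem BLMW2011_lemma_9_4_1_of_laurentPoints
    (H : ∀ {m n : Type} [Fintype m] [DecidableEq m] [Fintype n] [DecidableEq n]
      (φ : n → MvPolynomial m ℂ) (h : MvPolynomial m ℂ) (y : n → ℂ),
      y ∈ zariskiClosure ((fun x : m → ℂ => fun i => eval x (φ i)) '' {x | eval x h ≠ 0}) →
      ∃ x : m → LaurentSeries ℂ, aeval x h ≠ 0 ∧
        ∀ i, ∃ q : PowerSeries ℂ, aeval x (φ i) = (q : LaurentSeries ℂ) ∧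
          PowerSeries.constantCoeff q = y i) :
    BLMW2011_lemma_9_4_1 := by
  intro N f g hf
  classical
  -- the finitely many monomials of degree `≤ deg g`
  set D := g.totalDegree with hD
  set S : Finset (Fin N →₀ ℕ) := (Finset.range (D + 1)).biUnion
    (fun n => (Finset.univ : Finset (Fin N)).finsuppAntidiag n) with hS
  have hmemS : ∀ {d : Fin N →₀ ℕ}, d ∈ S ↔ d.degree ≤ D := fun {d} => by
    rw [hS]; exact mem_degBox_iff'
  -- the Laurent point
  obtain ⟨x, hxdet, hxq⟩ := H (fun d : ↥S => orbitCoeffPoly g d.1)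
    (Matrix.mvPolynomialX (Fin N) (Fin N) ℂ).det (fun d : ↥S => coeff d.1 f)
    (coeff_restrict_mem_zariskiClosure hf S)
  choose q hq using hxq
  set A : Matrix (Fin N) (Fin N) (LaurentSeries ℂ) := Matrix.of fun i j => x (i, j) with hA
  -- the power-series polynomial `F`
  set F : MvPolynomial (Fin N) (PowerSeries ℂ) := ∑ d ∈ S.attach, monomial d.1 (q d) with hF
  have hcoeffF : ∀ d : Fin N →₀ ℕ, coeff d F = if hd : d ∈ S then q ⟨d, hd⟩ else 0 := by
    intro d
    rw [hF, coeff_sum]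
    by_cases hd : d ∈ S
    · rw [dif_pos hd, Finset.sum_eq_single ⟨d, hd⟩]
      · rw [coeff_monomial, if_pos rfl]
      · intro e _ hne
        rw [coeff_monomial, if_neg]
        exact fun h => hne (Subtype.ext h)
      · intro h; exact absurd (Finset.mem_attach _ _) h
    · rw [dif_neg hd]
      refine Finset.sum_eq_zero fun e _ => ?_
      rw [coeff_monomial, if_neg]
      rintro rfl; exact hd e.2
  refine ⟨A, F, ?_, ?_, ?_⟩
  · -- `σ ∈ GL_N(K)`
    rw [hA, ← aeval_det_mvPolynomialX (k := ℂ) (S := LaurentSeries ℂ) x]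
    exact isUnit_iff_ne_zero.mpr hxdet
  · -- `σ·g = F`
    refine MvPolynomial.ext _ _ fun d => ?_
    rw [coeff_map, hcoeffF]
    by_cases hd : d ∈ S
    · rw [dif_pos hd, hA, ← aeval_orbitCoeffPoly (k := ℂ) (S := LaurentSeries ℂ) g d x, (hq ⟨d, hd⟩).1,
        LaurentSeries.coe_algebraMap]
    · rw [dif_neg hd, map_zero]
      exact coeff_linSubst_map_eq_zero _ A g (lt_of_not_ge fun h => hd (hmemS.mpr h))
  · -- `F(ε = 0) = f`
    refine MvPolynomial.ext _ _ fun d => ?_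
    rw [coeff_map, hcoeffF]
    by_cases hd : d ∈ S
    · rw [dif_pos hd]
      exact (hq ⟨d, hd⟩).2
    · rw [dif_neg hd, map_zero]
      exact (coeff_eq_zero_of_mem_orbitClosure hf (lt_of_not_ge fun h => hd (hmemS.mpr h))).symm

/-! ### From the algebraic core: Laurent points of a finitely generated domain -/

namespace HilbertKraft

/-- The Zariski closure of the empty set of an affine space is empty (the constant polynomial `1`
vanishes on `∅`). [cite: BurgisserEtAl2011, §9.3 (Def. 9.3.1)] -/
theorem not_mem_zariskiClosure_empty' {ι : Type} (x : ι → ℂ) :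
    x ∉ zariskiClosure (∅ : Set (ι → ℂ)) := fun hx =>
  one_ne_zero ((map_one (aeval x)).symm.trans
    ((mem_zariskiClosure_iff.mp hx) 1 fun _ h => h.elim))

/-- **The Laurent-point lemma from the algebraic core.** CORE (hypothesis `HC`, NOT asserted
here): for every finitely generated commutative `ℂ`-domain `R`, every finite family `a : n → R`
and every point `y ∈ ℂⁿ` satisfying all polynomial relations of `a` (`p(a) = 0 ⇒ p(y) = 0`),
there is a `ℂ`-algebra homomorphism `Ψ : R → ℂ((ε))` such that each `Ψ(p(a))` is a power series
with constant coefficient `p(y)`. CONCLUSION: the Laurent-point lemma `H` of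
`BLMW2011_lemma_9_4_1_of_laurentPoints` — apply CORE to the localisation `R = ℂ[x][h⁻¹]`
(the coordinate ring of the basic open set `D(h)`, a finitely generated domain) with
`a_i = φ_i`; the relations of the `a_i` hold at `y` because `y` lies in the Zariski closure of
`φ(D(h))`; `x(ε) := Ψ(x_j)`, and `h(x(ε)) = Ψ(h) ≠ 0` since `h` is a unit of `R`.
[cite: Kraft1984, III.2.3 Lemma 1 (proof)] [cite: BurgisserEtAl2011, Lemma 9.4.1 (proof)] -/
theorem laurentPoints_of_core
    (HC : ∀ (R : Type) [CommRing R] [IsDomain R] [Algebra ℂ R] [Algebra.FiniteType ℂ R]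
      {n : Type} [Fintype n] (a : n → R) (y : n → ℂ),
      (∀ p : MvPolynomial n ℂ, aeval a p = 0 → aeval y p = 0) →
      ∃ Ψ : R →ₐ[ℂ] LaurentSeries ℂ, ∀ p : MvPolynomial n ℂ, ∃ q : PowerSeries ℂ,
        Ψ (aeval a p) = (q : LaurentSeries ℂ) ∧ PowerSeries.constantCoeff q = aeval y p)
    {m n : Type} [Fintype m] [DecidableEq m] [Fintype n] [DecidableEq n]
    (φ : n → MvPolynomial m ℂ) (h : MvPolynomial m ℂ) (y : n → ℂ)
    (hy : y ∈ zariskiClosure ((fun x : m → ℂ => fun i => eval x (φ i)) '' {x | eval x h ≠ 0})) :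
    ∃ x : m → LaurentSeries ℂ, aeval x h ≠ 0 ∧
      ∀ i, ∃ q : PowerSeries ℂ, aeval x (φ i) = (q : LaurentSeries ℂ) ∧
        PowerSeries.constantCoeff q = y i := by
  classical
  -- `h ≠ 0`, else the basic open set and the closure of its image are empty
  have hh : h ≠ 0 := by
    rintro rfl
    have he : ((fun x : m → ℂ => fun i => eval x (φ i)) '' {x | eval x (0 : MvPolynomial m ℂ) ≠ 0})
        = ∅ := by
      rw [Set.image_eq_empty]
      ext x
      simp
    rw [he] at hy
    exact not_mem_zariskiClosure_empty' y hy
  -- the coordinate ring of `D(h)`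
  let R := Localization.Away h
  haveI : IsDomain R :=
    IsLocalization.isDomain_localization (powers_le_nonZeroDivisors_of_noZeroDivisors hh)
  let ι : MvPolynomial m ℂ →ₐ[ℂ] R := IsScalarTower.toAlgHom ℂ (MvPolynomial m ℂ) R
  have hι : ∀ P, ι P = algebraMap (MvPolynomial m ℂ) R P := fun P => rfl
  let a : n → R := fun i => ι (φ i)
  have ha : ∀ p : MvPolynomial n ℂ, aeval a p = ι (aeval φ p) := fun p => by
    rw [← AlgHom.comp_apply, MvPolynomial.comp_aeval]
  -- the relations of the `a_i` hold at `y`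
  have hrel : ∀ p : MvPolynomial n ℂ, aeval a p = 0 → aeval y p = 0 := by
    intro p hp
    rw [ha, hι, IsLocalization.map_eq_zero_iff (Submonoid.powers h)] at hp
    obtain ⟨⟨u, e, rfl⟩, hu⟩ := hp
    have hp0 : aeval φ p = 0 := by
      rcases mul_eq_zero.mp hu with h1 | h1
      · exact absurd h1 (pow_ne_zero e hh)
      · exact h1
    refine (mem_zariskiClosure_iff.mp hy) p ?_
    rintro _ ⟨x, -, rfl⟩
    have hcomp : aeval (fun i => eval x (φ i)) p = aeval x (aeval φ p) := by
      rw [← AlgHom.comp_apply, MvPolynomial.comp_aeval]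
      rfl
    rw [hcomp, hp0, map_zero]
  obtain ⟨Ψ, hΨ⟩ := HC R a y hrel
  -- the Laurent point `x(ε) := Ψ(x)`
  have hxhom : (aeval fun j => Ψ (ι (X j)) : MvPolynomial m ℂ →ₐ[ℂ] LaurentSeries ℂ) = Ψ.comp ι :=
    MvPolynomial.algHom_ext fun j => by rw [aeval_X, AlgHom.comp_apply]
  have hx : ∀ P : MvPolynomial m ℂ, aeval (fun j => Ψ (ι (X j))) P = Ψ (ι P) := fun P => by
    rw [hxhom, AlgHom.comp_apply]
  refine ⟨fun j => Ψ (ι (X j)), ?_, fun i => ?_⟩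
  · rw [hx, hι]
    exact ((IsLocalization.Away.algebraMap_isUnit (S := R) h).map Ψ).ne_zero
  · obtain ⟨q, hq, hq0⟩ := hΨ (X i)
    refine ⟨q, ?_, by rw [hq0, aeval_X]⟩
    rw [← hq, aeval_X]
    exact hx (φ i)

end HilbertKraft

open HilbertKraft in
/-- **BLMW 2011, Lemma 9.4.1, from the algebraic core alone**: CORE (see
`HilbertKraft.laurentPoints_of_core`; an explicit hypothesis, not a fact) implies the named fact
`BLMW2011_lemma_9_4_1`. [cite: BurgisserEtAl2011, Lemma 9.4.1] [cite: Kraft1984, III.2.3 Lemma 1] -/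
theorem BLMW2011_lemma_9_4_1_of_core
    (HC : ∀ (R : Type) [CommRing R] [IsDomain R] [Algebra ℂ R] [Algebra.FiniteType ℂ R]
      {n : Type} [Fintype n] (a : n → R) (y : n → ℂ),
      (∀ p : MvPolynomial n ℂ, aeval a p = 0 → aeval y p = 0) →
      ∃ Ψ : R →ₐ[ℂ] LaurentSeries ℂ, ∀ p : MvPolynomial n ℂ, ∃ q : PowerSeries ℂ,
        Ψ (aeval a p) = (q : LaurentSeries ℂ) ∧ PowerSeries.constantCoeff q = aeval y p) :
    BLMW2011_lemma_9_4_1 :=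
  BLMW2011_lemma_9_4_1_of_laurentPoints fun φ h y hy => laurentPoints_of_core HC φ h y hy

end Literature.Computability.AlgebraicComplexity

end
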